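import Literature.Geometry.Lorentzian.CoordWeightedPoincareVector
import HarnessLib

/-!
# The exponentially weighted Poincaré inequality at a boundary, for vector fields
# (Chruściel–Delay 2003, App. C, Prop. C.4)

Topic `Literature/Geometry/Lorentzian`, coordinate tensor calculus `MetricCoord` (Riemannian metric
components `G` on an open set `V`). Everything here is PROVED; no definition and no statement of
`Prop` type is introduced.

The vector-field case of Prop. C.4 of Chruściel–Delay (Mém. SMF 94 (2003)), obtained from the
vector-field Prop. C.2 (`IsMetricOn.integral_weightedPoincareVector`) exactly as the scalar case
(`CoordWeightedPoincareBoundary.lean`) is obtained from the scalar Prop. C.2: with the weight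
`v = −s/x + t log x` of a boundary defining function `x`,

* `IsMetricOn.boundaryWeight_pointwise_le` — on a small collar `{0 < x < x₀}`,
  `(s² − ε)|∇x|²/x⁴ ≤ Δv + |∇v|²` (the pointwise comparison of the scalar proof, isolated);
* **`IsMetricOn.integral_weightedPoincareVector_boundary`** — **Prop. C.4 for vector fields**:
  `(s² − ε) ∫ √det g · x^{2t−4} e^{−2s/x}|dx|²|U|² dμ ≤ ∫ √det g · x^{2t} e^{−2s/x}|∇U|² dμ`
  for `U` smooth on `V` with compact support in `{0 < x < x₀}` — the inequality applied with
  `U = x²∇N` in the proof of Thm. 5.9 (p. 29).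

## References

* P. T. Chruściel, E. Delay, Mém. Soc. Math. Fr. 94 (2003), App. C, Prop. C.2, Prop. C.4; proof
  of Thm. 5.9. [ChruscielDelay2003]
-/

noncomputable section

set_option maxSynthPendingDepth 3

open Set Filter Module Function MeasureTheory
open scoped Topology ContDiff

namespace Literature.Geometry.Lorentzian

namespace MetricCoord

variable {E : Type*} [NormedAddCommGroup E] [NormedSpace ℝ E] [FiniteDimensional ℝ E]
  [CompleteSpace E] {ι : Type*} [Fintype ι] [DecidableEq ι] (b : Basis ι ℝ E)
  {G : E → E →L[ℝ] E →L[ℝ] ℝ} {V : Set E} {U : E → E}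

/-! ### The pointwise comparison of the weights on the collar -/

omit [CompleteSpace E] [Fintype ι] [DecidableEq ι] in
/-- **The pointwise comparison of Prop. C.4**: if `m ≤ |∇x|²` and `|Δx| ≤ M` on `{0 < x < x₁}`,
then with `A = (|s| + |t|)M + 1`, `B' = |2st − 2s| + |t² − t| + 1` and
`x₀ = min (min 1 x₁) (min (εm/(2A)) (ε/(2B')))`, at every point of `V` with `0 < x < x₀`,
`(s² − ε)|∇x|²/x⁴ ≤ Δv + |∇v|²` for `v = −s/x + t log x`.
[cite: ChruscielDelay2003, App. C, Prop. C.4] -/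
theorem IsMetricOn.boundaryWeight_pointwise_le (hG : IsMetricOn G V) {xf : E → ℝ}
    (hxf : ContDiffOn ℝ ∞ xf V) {x₁ m M : ℝ} (hm : 0 < m) (hM : 0 ≤ M)
    (hgrad : ∀ y ∈ V, 0 < xf y → xf y < x₁ → m ≤ gradSqAt G xf y)
    (hlap : ∀ y ∈ V, 0 < xf y → xf y < x₁ → |lapAt G xf y| ≤ M) (s t : ℝ) {ε : ℝ} (hε : 0 < ε)
    {y : E} (hy : y ∈ V) (hx : 0 < xf y)
    (hyx : xf y < min (min 1 x₁) (min (ε * m / (2 * ((|s| + |t|) * M + 1)))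
      (ε / (2 * (|2 * s * t - 2 * s| + |t ^ 2 - t| + 1))))) :
    (s ^ 2 - ε) * (gradSqAt G xf y / xf y ^ 4) ≤
      lapAt G (fun z ↦ -s / xf z + t * Real.log (xf z)) y
        + gradSqAt G (fun z ↦ -s / xf z + t * Real.log (xf z)) y := by
  set A : ℝ := (|s| + |t|) * M + 1 with hA
  set B' : ℝ := |2 * s * t - 2 * s| + |t ^ 2 - t| + 1 with hB'
  have hA0 : 0 < A := by positivity
  have hB0 : 0 < B' := by positivity
  set x₀ : ℝ := min (min 1 x₁) (min (ε * m / (2 * A)) (ε / (2 * B'))) with hx₀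
  have hx₀1 : x₀ ≤ 1 := (min_le_left _ _).trans (min_le_left _ _)
  have hx₀x₁ : x₀ ≤ x₁ := (min_le_left _ _).trans (min_le_right _ _)
  have hx₀A : x₀ ≤ ε * m / (2 * A) := (min_le_right _ _).trans (min_le_left _ _)
  have hx₀B : x₀ ≤ ε / (2 * B') := (min_le_right _ _).trans (min_le_right _ _)
  have hx1 : xf y ≤ 1 := (hyx.le.trans hx₀1)
  have hxx₁ : xf y < x₁ := hyx.trans_le hx₀x₁
  have hg2 : m ≤ gradSqAt G xf y := hgrad y hy hx hxx₁
  have hL : |lapAt G xf y| ≤ M := hlap y hy hx hxx₁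
  have hxf2 : ContDiffAt ℝ 2 xf y :=
    ((hxf y hy).contDiffAt (hG.mem_nhds hy)).of_le (by norm_cast)
  rw [lapAt_add_gradSqAt_boundaryWeight s t hx hxf2]
  -- reduce to a polynomial inequality in `x`, `Δx`, `|∇x|²`
  set X : ℝ := xf y with hX
  set L : ℝ := lapAt G xf y with hLdef
  set g2 : ℝ := gradSqAt G xf y with hg2def
  have hg2pos : 0 < g2 := hm.trans_le hg2
  have hX4 : 0 < X ^ 4 := by positivity
  -- the two error terms
  have e1 : |(s * X ^ 2 + t * X ^ 3) * L| ≤ ε / 2 * g2 := by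
    have h1 : |s * X ^ 2 + t * X ^ 3| ≤ (|s| + |t|) * X ^ 2 := by
      calc |s * X ^ 2 + t * X ^ 3| ≤ |s * X ^ 2| + |t * X ^ 3| := abs_add_le _ _
        _ = |s| * X ^ 2 + |t| * X ^ 3 := by
            rw [abs_mul, abs_mul, abs_of_pos (by positivity : 0 < X ^ 2),
              abs_of_pos (by positivity : 0 < X ^ 3)]
        _ ≤ |s| * X ^ 2 + |t| * X ^ 2 := by
            gcongr _ + |t| * ?_
            calc X ^ 3 = X ^ 2 * X := by ring
              _ ≤ X ^ 2 * 1 := by gcongr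
              _ = X ^ 2 := by ring
        _ = (|s| + |t|) * X ^ 2 := by ring
    have h2 : X ^ 2 ≤ X := by nlinarith
    have h3 : X ≤ ε * m / (2 * A) := hyx.le.trans hx₀A
    have h4 : (|s| + |t|) * M ≤ A := by rw [hA]; linarith
    have h5 : X ^ 2 ≤ ε * m / (2 * A) := h2.trans h3
    calc |(s * X ^ 2 + t * X ^ 3) * L| = |s * X ^ 2 + t * X ^ 3| * |L| := abs_mul _ _
      _ ≤ (|s| + |t|) * X ^ 2 * M := by gcongr
      _ = (|s| + |t|) * M * X ^ 2 := by ring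
      _ ≤ (|s| + |t|) * M * (ε * m / (2 * A)) := by gcongr
      _ ≤ A * (ε * m / (2 * A)) := by gcongr
      _ = ε / 2 * m := by field_simp
      _ ≤ ε / 2 * g2 := by gcongr
  have e2 : |((2 * s * t - 2 * s) * X + (t ^ 2 - t) * X ^ 2) * g2| ≤ ε / 2 * g2 := by
    have h1 : |(2 * s * t - 2 * s) * X + (t ^ 2 - t) * X ^ 2| ≤ B' * X := by
      calc |(2 * s * t - 2 * s) * X + (t ^ 2 - t) * X ^ 2|
          ≤ |(2 * s * t - 2 * s) * X| + |(t ^ 2 - t) * X ^ 2| := abs_add_le _ _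
        _ = |2 * s * t - 2 * s| * X + |t ^ 2 - t| * X ^ 2 := by
            rw [abs_mul, abs_mul, abs_of_pos hx, abs_of_pos (by positivity : 0 < X ^ 2)]
        _ ≤ |2 * s * t - 2 * s| * X + |t ^ 2 - t| * X := by
            gcongr _ + |t ^ 2 - t| * ?_
            nlinarith
        _ ≤ B' * X := by rw [hB']; nlinarith [abs_nonneg (2 * s * t - 2 * s), abs_nonneg (t ^ 2 - t)]
    have h3 : X ≤ ε / (2 * B') := hyx.le.trans hx₀B
    calc |((2 * s * t - 2 * s) * X + (t ^ 2 - t) * X ^ 2) * g2|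
        = |(2 * s * t - 2 * s) * X + (t ^ 2 - t) * X ^ 2| * g2 := by
          rw [abs_mul, abs_of_pos hg2pos]
      _ ≤ B' * X * g2 := by gcongr
      _ ≤ B' * (ε / (2 * B')) * g2 := by gcongr
      _ = ε / 2 * g2 := by field_simp
  -- conclude
  have key : (s ^ 2 - ε) * g2 ≤
      (s * X ^ 2 + t * X ^ 3) * L + (s ^ 2 + (2 * s * t - 2 * s) * X + (t ^ 2 - t) * X ^ 2) * g2 := by
    have a1 := neg_abs_le ((s * X ^ 2 + t * X ^ 3) * L)
    have a2 := neg_abs_le (((2 * s * t - 2 * s) * X + (t ^ 2 - t) * X ^ 2) * g2)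
    nlinarith [a1, a2, e1, e2]
  have hX0 : X ≠ 0 := hx.ne'
  rw [mul_div_assoc', div_le_iff₀ hX4]
  calc (s ^ 2 - ε) * g2 ≤ (s * X ^ 2 + t * X ^ 3) * L
        + (s ^ 2 + (2 * s * t - 2 * s) * X + (t ^ 2 - t) * X ^ 2) * g2 := key
    _ = ((s / X ^ 2 + t / X) * L
        + (s ^ 2 / X ^ 4 + (2 * s * t - 2 * s) / X ^ 3 + (t ^ 2 - t) / X ^ 2) * g2) * X ^ 4 := by
        field_simp

/-! ### Prop. C.4 for vector fields -/

omit [FiniteDimensional ℝ E] [CompleteSpace E] [Fintype ι] [DecidableEq ι] in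
/-- Metric components on `V` are metric components on every open `U ⊆ V`. [folklore] -/
private theorem IsMetricOn.monoVec (hG : IsMetricOn G V) {W : Set E} (hW : IsOpen W) (hWV : W ⊆ V) :
    IsMetricOn G W :=
  ⟨hW, hG.contDiffOn.mono hWV, fun y hy ↦ hG.symm y (hWV hy), fun y hy ↦ hG.isInvertible y (hWV hy)⟩

section Integral

variable [MeasurableSpace E] [BorelSpace E] (μ : Measure E) [μ.IsAddHaarMeasure]

/-- **The exponentially weighted Poincaré inequality at a boundary, for vector fields**
(Chruściel–Delay 2003, App. C, Prop. C.4), in coordinates. Let `G` be Riemannian metric components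
on `V` and `x` a smooth function on `V` with `m ≤ |∇x|²` and `|Δx| ≤ M` on `{0 < x < x₁}`
(`m > 0`). Then for all reals `s, t` and every `ε > 0` there is `x₀ > 0` such that for every vector
field `U` smooth on `V` with compact support inside `{0 < x < x₀}`,
`(s² − ε) ∫ √det g · e^{2(−s/x + t log x)} (|∇x|²/x⁴) |U|²_G dμ
   ≤ ∫ √det g · e^{2(−s/x + t log x)} |∇U|²_G dμ`, `|∇U|²_G = tr_G G(∇·U, ∇·U)`.
Proof as printed: Prop. C.2 (vector case) with `e^{v} = x^t e^{−s/x}`, `w = 0`, and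
`Δv + |∇v|² = x⁻⁴(s²|dx|² + O(x))`. [cite: ChruscielDelay2003, App. C, Prop. C.4] -/
theorem IsMetricOn.integral_weightedPoincareVector_boundary (hG : IsMetricOn G V)
    (hpos : ∀ y ∈ V, ∀ e : E, e ≠ 0 → 0 < G y e e) {xf : E → ℝ} (hxf : ContDiffOn ℝ ∞ xf V)
    {x₁ m M : ℝ} (hx₁ : 0 < x₁) (hm : 0 < m) (hM : 0 ≤ M)
    (hgrad : ∀ y ∈ V, 0 < xf y → xf y < x₁ → m ≤ gradSqAt G xf y)
    (hlap : ∀ y ∈ V, 0 < xf y → xf y < x₁ → |lapAt G xf y| ≤ M) (s t : ℝ) {ε : ℝ} (hε : 0 < ε) :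
    ∃ x₀ : ℝ, 0 < x₀ ∧ ∀ U : E → E, ContDiffOn ℝ ∞ U V → HasCompactSupport U →
      tsupport U ⊆ {y ∈ V | 0 < xf y ∧ xf y < x₀} →
      (s ^ 2 - ε) * ∫ y, sqrtDetGram G b y *
          (Real.exp (2 * (-s / xf y + t * Real.log (xf y))) * (gradSqAt G xf y / xf y ^ 4)
            * G y (U y) (U y)) ∂μ ≤
        ∫ y, sqrtDetGram G b y *
          (Real.exp (2 * (-s / xf y + t * Real.log (xf y)))
            * mtrAt G y ((G y).bilinearComp (covDAt G U y) (covDAt G U y))) ∂μ := by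
  set x₀ : ℝ := min (min 1 x₁) (min (ε * m / (2 * ((|s| + |t|) * M + 1)))
      (ε / (2 * (|2 * s * t - 2 * s| + |t ^ 2 - t| + 1)))) with hx₀
  have hx₀pos : 0 < x₀ := by positivity
  refine ⟨x₀, hx₀pos, fun U hU hsupp hUS ↦ ?_⟩
  -- the open collar `V' = V ∩ {x > 0}` and the weight
  set V' : Set E := {y ∈ V | 0 < xf y} with hV'
  have hV'o : IsOpen V' := hxf.continuousOn.isOpen_inter_preimage hG.isOpen isOpen_Ioi
  have hV'V : V' ⊆ V := fun y hy ↦ hy.1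
  have hG' : IsMetricOn G V' := hG.monoVec hV'o hV'V
  have hpos' : ∀ y ∈ V', ∀ e : E, e ≠ 0 → 0 < G y e e := fun y hy ↦ hpos y hy.1
  have hUV' : tsupport U ⊆ V' := fun y hy ↦ ⟨(hUS hy).1, (hUS hy).2.1⟩
  have hU' : ContDiffOn ℝ ∞ U V' := hU.mono hV'V
  have hxf' : ContDiffOn ℝ ∞ xf V' := hxf.mono hV'V
  have hne : ∀ y ∈ V', xf y ≠ 0 := fun y hy ↦ hy.2.ne'
  set v : E → ℝ := fun y ↦ -s / xf y + t * Real.log (xf y) with hvdef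
  have hv : ContDiffOn ℝ ∞ v V' := by
    have h1 : ContDiffOn ℝ ∞ (fun y ↦ (xf y)⁻¹) V' := hxf'.inv hne
    have h2 : ContDiffOn ℝ ∞ (fun y ↦ Real.log (xf y)) V' := hxf'.log hne
    have h := (h1.const_smul (-s)).add (h2.const_smul t)
    refine h.congr fun y _ ↦ ?_
    simp only [hvdef, smul_eq_mul, div_eq_mul_inv, neg_mul]
  -- Prop. C.2 (vector case) on the collar with `w = 0`
  have hC2 := hG'.integral_weightedPoincareVector b μ hpos' hU' hsupp hUV' hv
    (contDiffOn_const (c := (0 : ℝ)))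
  have h0g : ∀ y, gradSqAt G (fun _ : E ↦ (0 : ℝ)) y = 0 := fun y ↦ by
    rw [gradSqAt_apply, fderiv_fun_const]; rfl
  simp only [lapAt_const, add_zero, h0g, sub_zero] at hC2
  -- `U` vanishes to first order off its support
  have hU0 : ∀ y ∉ tsupport U, U y = 0 ∧ fderiv ℝ U y = 0 := by
    intro y hy
    have hyu : U =ᶠ[𝓝 y] fun _ ↦ 0 := notMem_tsupport_iff_eventuallyEq.mp hy
    exact ⟨hyu.self_of_nhds, by rw [hyu.fderiv_eq, fderiv_fun_const]; rfl⟩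
  -- integrability
  have hnUs : ContDiffOn ℝ ∞ (fun y ↦ G y (U y) (U y)) V' :=
    (hG'.contDiffOn.clm_apply hU').clm_apply hU'
  have hI : ∀ {k : E → ℝ}, ContDiffOn ℝ ∞ k V' → (∀ z, U z = 0 → k z = 0) →
      Integrable (fun z ↦ sqrtDetGram G b z * k z) μ := fun hk hk0 ↦
    hG'.integrable_sqrtDetGram_mul_of_vanishing_vec b μ hpos' hsupp hUV' hk hk0
  have hI₁ : Integrable (fun y ↦ sqrtDetGram G b y * ((s ^ 2 - ε) *
      (Real.exp (2 * v y) * (gradSqAt G xf y / xf y ^ 4) * G y (U y) (U y)))) μ := by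
    refine hI ?_ fun z hz ↦ ?_
    · exact contDiffOn_const.mul ((((contDiffOn_const.mul hv).exp).mul
        ((hG'.contDiffOn_gradSqAt hxf').div (hxf'.pow 4) fun y hy ↦ pow_ne_zero 4 (hne y hy))).mul
        hnUs)
    · simp only [hz, map_zero, mul_zero]
  have hI₂ : Integrable (fun y ↦ sqrtDetGram G b y *
      (Real.exp (2 * v y) * (lapAt G v y + gradSqAt G v y) * G y (U y) (U y))) μ := by
    refine hI ?_ fun z hz ↦ ?_
    · exact (((contDiffOn_const.mul hv).exp).mul
        ((hG'.contDiffOn_lapAt hv).add (hG'.contDiffOn_gradSqAt hv))).mul hnUs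
    · simp only [hz, map_zero, mul_zero]
  have hmono : ∫ y, sqrtDetGram G b y * ((s ^ 2 - ε) *
      (Real.exp (2 * v y) * (gradSqAt G xf y / xf y ^ 4) * G y (U y) (U y))) ∂μ ≤
      ∫ y, sqrtDetGram G b y *
        (Real.exp (2 * v y) * (lapAt G v y + gradSqAt G v y) * G y (U y) (U y)) ∂μ := by
    refine integral_mono hI₁ hI₂ fun y ↦ ?_
    show sqrtDetGram G b y * ((s ^ 2 - ε) *
      (Real.exp (2 * v y) * (gradSqAt G xf y / xf y ^ 4) * G y (U y) (U y))) ≤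
      sqrtDetGram G b y * (Real.exp (2 * v y) * (lapAt G v y + gradSqAt G v y) * G y (U y) (U y))
    by_cases hy : y ∈ tsupport U
    · have hyV' := hUV' hy
      have hnU : 0 ≤ G y (U y) (U y) := by
        by_cases h0 : U y = 0
        · simp [h0]
        · exact (hpos' y hyV' _ h0).le
      have hw : 0 ≤ sqrtDetGram G b y * (Real.exp (2 * v y) * G y (U y) (U y)) :=
        mul_nonneg (Real.sqrt_nonneg _) (mul_nonneg (Real.exp_nonneg _) hnU)
      have hpt := hG.boundaryWeight_pointwise_le hxf hm hM hgrad hlap s t hε hyV'.1 hyV'.2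
        (hUS hy).2.2
      have h := mul_le_mul_of_nonneg_left hpt hw
      calc sqrtDetGram G b y * ((s ^ 2 - ε) *
            (Real.exp (2 * v y) * (gradSqAt G xf y / xf y ^ 4) * G y (U y) (U y)))
          = sqrtDetGram G b y * (Real.exp (2 * v y) * G y (U y) (U y)) *
            ((s ^ 2 - ε) * (gradSqAt G xf y / xf y ^ 4)) := by ring
        _ ≤ sqrtDetGram G b y * (Real.exp (2 * v y) * G y (U y) (U y))
            * (lapAt G v y + gradSqAt G v y) := h
        _ = sqrtDetGram G b y *
            (Real.exp (2 * v y) * (lapAt G v y + gradSqAt G v y) * G y (U y) (U y)) := by ring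
    · simp only [(hU0 y hy).1, map_zero, mul_zero, le_refl]
  rw [← integral_const_mul]
  calc ∫ y, (s ^ 2 - ε) * (sqrtDetGram G b y *
        (Real.exp (2 * (-s / xf y + t * Real.log (xf y))) * (gradSqAt G xf y / xf y ^ 4)
          * G y (U y) (U y))) ∂μ
      = ∫ y, sqrtDetGram G b y * ((s ^ 2 - ε) *
        (Real.exp (2 * v y) * (gradSqAt G xf y / xf y ^ 4) * G y (U y) (U y))) ∂μ := by
        congr 1; ext y; simp only [hvdef]; ring
    _ ≤ _ := hmono
    _ ≤ _ := hC2

end Integral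

end MetricCoord

end Literature.Geometry.Lorentzian

end
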